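import Summits.Ventures.PercRepro.ProfileGapMonoThresholdThreeLinesBad

/-!
# PercRepro — LINES OF AT MOST 3 POINTS AT CO-RANK 3, III: THE DISJOINT RULE (`t + 3 = #E`) (p5, gen 29;
`proofs/P5-GM1.md` §34(3); announced INBOX 13565)

A bad set `B` has `cl B = B ∪ {c}` (`clF_eq_insert_of_bad`), and a bad point `c` lies on a unique bad line
(`eq_of_bad_of_mem_sdiff`: `B' ⊆ E ∖ cl B` would put `c ∈ cl (E ∖ cl B)` against the independence of `E ∖ B`,
otherwise the two lines share two points).  Some outside point `x₁` leaves `(E ∖ c) ∖ x₁` independent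
(`exists_erase_indep_of_bad`: `E ∖ c` has nullity `≤ 1`, and all outside points coloops of `E ∖ c` would force
`ρ(B) = 1`).  The target of `B` is the independent triple `{c, x₁, x₂}` with independent complement of rank `t`;
its pair `(S, c)` is free (`{x₁, x₂} ∉ L_t`), and on a fibre `B ↦ c` is injective: **`card_bad_le_of_add_three_eq`**.
-/

open scoped Matroid

namespace PercRepro.Cogirth

open Finset ThmH Skew Shadow Profile

variable {α : Type} [DecidableEq α] {N : Matroid α} [N.Finite]

section Disjoint

variable {t : ℕ}

/-- **The third point of a bad line**: `cl B = B ∪ {c}` for the unique `c ∈ cl B ∖ B`. -/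
theorem clF_eq_insert_of_bad {B : Finset α} (hB : B ∈ Rq N 2)
    (hbad : B.card = 2 ∧ (clF N B).card = 3 ∧ rk N (gr N \ B) = (gr N \ B).card) {c : α}
    (hc : c ∈ clF N B \ B) : clF N B = insert c B := by
  have hBg := (mem_Rq.1 hB).1
  have hBcl : B ⊆ clF N B := subset_clF hBg
  have h1 : (clF N B \ B).card = 1 := by
    rw [card_sdiff_of_subset hBcl, hbad.2.1, hbad.1]
  obtain ⟨c', hc'⟩ := card_eq_one.1 h1
  have hcc : c = c' := by
    have := hc
    rw [hc', mem_singleton] at this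
    exact this
  subst hcc
  apply Subset.antisymm
  · intro y hy
    by_cases hyB : y ∈ B
    · exact mem_insert_of_mem hyB
    · have : y ∈ clF N B \ B := mem_sdiff.2 ⟨hy, hyB⟩
      rw [hc', mem_singleton] at this
      rw [this]
      exact mem_insert_self _ _
  · exact insert_subset (mem_sdiff.1 hc).1 hBcl

/-- **A bad point lies on a unique bad line**: if `c ∈ cl B ∖ B` and `c ∈ cl B' ∖ B'` for bad `B`, `B'`, then `B = B'`
(`B' ⊆ E ∖ cl B` would put `c ∈ cl(E ∖ cl B)` against the independence of `E ∖ B`; otherwise the lines share two points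
and coincide). -/
theorem eq_of_bad_of_mem_sdiff (hpair : ∀ x ∈ gr N, ∀ y ∈ gr N, x ≠ y → rk N {x, y} = 2)
    {B B' : Finset α} (hB : B ∈ Rq N 2) (hB' : B' ∈ Rq N 2)
    (hbad : B.card = 2 ∧ (clF N B).card = 3 ∧ rk N (gr N \ B) = (gr N \ B).card)
    (hbad' : B'.card = 2 ∧ (clF N B').card = 3 ∧ rk N (gr N \ B') = (gr N \ B').card) {c : α}
    (hc : c ∈ clF N B \ B) (hc' : c ∈ clF N B' \ B') : B = B' := by
  obtain ⟨hBg, hBr⟩ := mem_Rq.1 hB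
  obtain ⟨hBg', hBr'⟩ := mem_Rq.1 hB'
  have hBrk : rk N B = 2 := rk_eq_of_eRk_eq_cq hBr
  have hBrk' : rk N B' = 2 := rk_eq_of_eRk_eq_cq hBr'
  have hcg : c ∈ gr N := clF_subset_gr _ (mem_sdiff.1 hc).1
  have hclB : clF N B = insert c B := clF_eq_insert_of_bad hB hbad hc
  have hclB' : clF N B' = insert c B' := clF_eq_insert_of_bad hB' hbad' hc'
  -- some point of `B'` lies in `cl B`
  have hp : ∃ p ∈ B', p ∈ clF N B := by
    by_contra hno
    push Not at hno
    have hsub : B' ⊆ gr N \ clF N B := fun p hp => mem_sdiff.2 ⟨hBg' hp, hno p hp⟩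
    have h1 : c ∈ clF N (gr N \ clF N B) := clF_mono hsub (mem_sdiff.1 hc').1
    have h2 := (mem_clF_iff_rk_insert hcg sdiff_subset).1 h1
    -- `insert c (E ∖ cl B) ⊆ E ∖ B` is independent
    have hsub2 : insert c (gr N \ clF N B) ⊆ gr N \ B :=
      insert_subset (mem_sdiff.2 ⟨hcg, (mem_sdiff.1 hc).2⟩)
        (sdiff_subset_sdiff (Subset.refl _) (subset_clF hBg))
    have h3 := rk_eq_card_of_subset_indepFin hsub2 hbad.2.2
    have hcO : c ∉ gr N \ clF N B := fun h => (mem_sdiff.1 h).2 (mem_sdiff.1 hc).1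
    rw [card_insert_of_notMem hcO] at h3
    have h4 := rk_le_card (M := N) (gr N \ clF N B)
    omega
  obtain ⟨p, hpB', hpcl⟩ := hp
  have hpg : p ∈ gr N := hBg' hpB'
  have hpc : p ≠ c := fun h => (mem_sdiff.1 hc').2 (h ▸ hpB')
  have hpc2 : rk N {p, c} = 2 := hpair p hpg c hcg hpc
  -- a line containing `p` and `c` is `cl {p, c}`
  have hline : ∀ D : Finset α, D ∈ Rq N 2 → p ∈ clF N D → c ∈ clF N D → clF N D = clF N {p, c} := by
    intro D hD hpD hcD
    have hDg := (mem_Rq.1 hD).1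
    have hDrk : rk N D = 2 := rk_eq_of_eRk_eq_cq (mem_Rq.1 hD).2
    have hpcD : ({p, c} : Finset α) ⊆ clF N D := insert_subset hpD (singleton_subset_iff.2 hcD)
    apply Subset.antisymm
    · intro y hy
      have hyg : y ∈ gr N := clF_subset_gr _ hy
      rw [mem_clF_iff_rk_insert hyg (insert_subset hpg (singleton_subset_iff.2 hcg)), hpc2]
      have h1 : rk N (insert y {p, c}) ≤ rk N (clF N D) := rk_mono' (insert_subset hy hpcD)
      have h2 : rk N {p, c} ≤ rk N (insert y {p, c}) := rk_mono' (subset_insert _ _)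
      rw [rk_clF, hDrk] at h1
      omega
    · exact (clF_mono hpcD).trans (clF_clF_subset_self D hDg)
  have hpB : p ∈ clF N B' := subset_clF hBg' hpB'
  have heq : clF N B = clF N B' := by
    rw [hline B hB hpcl (mem_sdiff.1 hc).1, hline B' hB' hpB (mem_sdiff.1 hc').1]
  have e1 : B = (clF N B).erase c := by rw [hclB, erase_insert (mem_sdiff.1 hc).2]
  have e2 : B' = (clF N B').erase c := by rw [hclB', erase_insert (mem_sdiff.1 hc').2]
  rw [e1, e2, heq]

/-- **An outside point whose removal from `E ∖ c` leaves an independent set exists**: `E ∖ c` has nullity `≤ 1`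
(`E ∖ B` is independent and `c ∈ cl B`), and if every point of `E ∖ cl B` were a coloop of `E ∖ c`, removing them
would leave `B` with `ρ(B) = #(E ∖ c) − 1 − #(E ∖ cl B) = 1`. -/
theorem exists_erase_indep_of_bad {B : Finset α} (hB : B ∈ Rq N 2)
    (hbad : B.card = 2 ∧ (clF N B).card = 3 ∧ rk N (gr N \ B) = (gr N \ B).card) {c : α}
    (hc : c ∈ clF N B \ B) (hO : (gr N \ clF N B).Nonempty) :
    ∃ x ∈ gr N \ clF N B,
      rk N (((gr N).erase c).erase x) = (((gr N).erase c).erase x).card := by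
  obtain ⟨hBg, hBr⟩ := mem_Rq.1 hB
  have hBrk : rk N B = 2 := rk_eq_of_eRk_eq_cq hBr
  have hcg : c ∈ gr N := clF_subset_gr _ (mem_sdiff.1 hc).1
  have hclB : clF N B = insert c B := clF_eq_insert_of_bad hB hbad hc
  set X := (gr N).erase c with hX
  have hXg : X ⊆ gr N := erase_subset _ _
  have hXc : X.card = (gr N).card - 1 := card_erase_of_mem hcg
  -- `ρ(X) = ρ(E) ≥ #E − 2`
  have hBX : B ⊆ X := fun b hb => mem_erase.2 ⟨fun h => (mem_sdiff.1 hc).2 (h ▸ hb), hBg hb⟩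
  have hcX : c ∈ clF N X := clF_mono hBX (mem_sdiff.1 hc).1
  have hrX : rk N X = rk N (gr N) := by
    have h := (mem_clF_iff_rk_insert hcg hXg).1 hcX
    rw [hX, insert_erase hcg] at h
    exact h.symm
  have hrE : (gr N).card - 2 ≤ rk N (gr N) := by
    have h1 : rk N (gr N \ B) ≤ rk N (gr N) := rk_mono' sdiff_subset
    rw [hbad.2.2, card_sdiff_of_subset hBg, hbad.1] at h1
    exact h1
  have hOc : (gr N \ clF N B).card = (gr N).card - 3 := by
    rw [card_sdiff_of_subset (clF_subset_gr B), hbad.2.1]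
  rcases lt_or_eq_of_le (rk_le_card (M := N) X) with hlt | hindep
  · -- `ρ(X) = #X − 1`: some outside point is not a coloop of `X`
    have hrX' : rk N X = X.card - 1 := by omega
    by_contra hno
    push Not at hno
    have hsub : gr N \ clF N B ⊆ coloops N X := by
      intro x hx
      by_contra hxc
      have hxX : x ∈ X := mem_erase.2 ⟨fun h => (mem_sdiff.1 hx).2 (h ▸ (mem_sdiff.1 hc).1), (mem_sdiff.1 hx).1⟩
      have h1 := rk_erase_of_notMem_coloops hXg hxX hxc
      have h2 : rk N (X.erase x) ≤ (X.erase x).card := rk_le_card _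
      have h3 : (X.erase x).card = X.card - 1 := card_erase_of_mem hxX
      have := hno x hx
      omega
    have h1 := rk_sdiff_add_card_of_subset_coloops hXg hsub
    have hXO : X \ (gr N \ clF N B) = B := by
      ext y
      simp only [hX, mem_sdiff, mem_erase, not_and, not_not]
      constructor
      · rintro ⟨⟨hyc, hyg⟩, h⟩
        have hycl : y ∈ clF N B := h hyg
        rw [hclB, mem_insert] at hycl
        rcases hycl with h' | h'
        · exact absurd h' hyc
        · exact h'
      · intro hy
        exact ⟨⟨fun h => (mem_sdiff.1 hc).2 (h ▸ hy), hBg hy⟩, fun _ => subset_clF hBg hy⟩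
    rw [hXO, hBrk, hOc] at h1
    omega
  · -- `X` independent: any outside point works
    obtain ⟨x, hx⟩ := hO
    refine ⟨x, hx, ?_⟩
    exact rk_eq_card_of_subset_indepFin (erase_subset _ _) hindep

/-- **The disjoint rule** (`2 ≤ t`, `t + 3 = #E`): the demanding bad sets number at most the slack
`Σ_{S∈T_t} (3 − d_t(S))` — a bad `B` with `cl B = B ∪ {c}` goes to the independent triple `S = {c, x₁, x₂}` outside
`cl B` with `E ∖ S` independent, whose pair `(S, c)` is free; on a fibre `B ↦ c` is injective. -/
theorem card_bad_le_of_add_three_eq (hpair : ∀ x ∈ gr N, ∀ y ∈ gr N, x ≠ y → rk N {x, y} = 2) (ht : 2 ≤ t)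
    (h3 : t + 3 = (gr N).card) :
    (((Rq N 2).filter (fun B => t + 1 ≤ rk N (gr N \ B))).filter
      (fun B => B.card = 2 ∧ (clF N B).card = 3 ∧ rk N (gr N \ B) = (gr N \ B).card)).card ≤
    ∑ S ∈ levelSetCoQ N t 3,
      (3 - ((coloops N S).filter
        (fun y => S.erase y ∈ (Rq N 2).filter (fun B => t + 1 ≤ rk N (gr N \ B)))).card) := by
  set L := (Rq N 2).filter (fun B => t + 1 ≤ rk N (gr N \ B)) with hL
  set BP := L.filter (fun B => B.card = 2 ∧ (clF N B).card = 3 ∧ rk N (gr N \ B) = (gr N \ B).card) with hBP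
  have hmem : ∀ B ∈ BP, B ∈ Rq N 2 ∧ t + 1 ≤ rk N (gr N \ B) ∧
      (B.card = 2 ∧ (clF N B).card = 3 ∧ rk N (gr N \ B) = (gr N \ B).card) := by
    intro B hB
    rw [hBP, mem_filter, hL, mem_filter] at hB
    exact ⟨hB.1.1, hB.1.2, hB.2⟩
  rcases BP.eq_empty_or_nonempty with hemp | ⟨B₀, hB₀⟩
  · rw [hemp, card_empty]
    exact Nat.zero_le _
  obtain ⟨a₀, _⟩ : B₀.Nonempty := by
    rw [← card_pos, (hmem B₀ hB₀).2.2.1]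
    norm_num
  haveI : Inhabited α := ⟨a₀⟩
  let pick : Finset α → α := fun X => if h : X.Nonempty then h.choose else default
  have hpick : ∀ X : Finset α, X.Nonempty → pick X ∈ X := by
    intro X h
    simp only [pick, dif_pos h]
    exact h.choose_spec
  let cpt : Finset α → α := fun B => pick (clF N B \ B)
  let Xof : Finset α → Finset α := fun B => (gr N).erase (cpt B)
  let x₁ : Finset α → α := fun B =>
    pick ((gr N \ clF N B).filter (fun x => rk N ((Xof B).erase x) = ((Xof B).erase x).card))
  let x₂ : Finset α → α := fun B => pick ((gr N \ clF N B).erase (x₁ B))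
  let f : Finset α → Finset α := fun B => insert (cpt B) {x₁ B, x₂ B}
  -- the data of a bad set
  have hc : ∀ B ∈ BP, cpt B ∈ clF N B \ B := by
    intro B hB
    obtain ⟨hBq, _, hbad⟩ := hmem B hB
    apply hpick
    rw [← card_pos, card_sdiff_of_subset (subset_clF (mem_Rq.1 hBq).1), hbad.2.1, hbad.1]
    norm_num
  have hOc : ∀ B ∈ BP, (gr N \ clF N B).card = t := by
    intro B hB
    rw [card_sdiff_of_subset (clF_subset_gr B), (hmem B hB).2.2.2.1]
    omega
  have hx₁ : ∀ B ∈ BP, x₁ B ∈ gr N \ clF N B ∧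
      rk N ((Xof B).erase (x₁ B)) = ((Xof B).erase (x₁ B)).card := by
    intro B hB
    obtain ⟨hBq, _, hbad⟩ := hmem B hB
    have hO : (gr N \ clF N B).Nonempty := by
      rw [← card_pos, hOc B hB]
      omega
    obtain ⟨x, hx, hxr⟩ := exists_erase_indep_of_bad hBq hbad (hc B hB) hO
    have hne : ((gr N \ clF N B).filter
        (fun x => rk N ((Xof B).erase x) = ((Xof B).erase x).card)).Nonempty :=
      ⟨x, mem_filter.2 ⟨hx, hxr⟩⟩
    have := hpick _ hne
    rw [mem_filter] at this
    exact this
  have hx₂ : ∀ B ∈ BP, x₂ B ∈ gr N \ clF N B ∧ x₂ B ≠ x₁ B := by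
    intro B hB
    have hne : ((gr N \ clF N B).erase (x₁ B)).Nonempty := by
      rw [← card_pos, card_erase_of_mem (hx₁ B hB).1, hOc B hB]
      omega
    have := hpick _ hne
    exact ⟨mem_of_mem_erase this, (mem_erase.1 this).1⟩
  have hcpair : ∀ B ∈ BP, cpt B ∉ ({x₁ B, x₂ B} : Finset α) := by
    intro B hB h
    have hccl := (mem_sdiff.1 (hc B hB)).1
    rcases mem_insert.1 h with h | h
    · exact (mem_sdiff.1 (hx₁ B hB).1).2 (h ▸ hccl)
    · exact (mem_sdiff.1 (hx₂ B hB).1).2 ((mem_singleton.1 h) ▸ hccl)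
  have hfsub : ∀ B ∈ BP, f B ⊆ gr N \ B := by
    intro B hB
    obtain ⟨hBq, _, _⟩ := hmem B hB
    have hBg := (mem_Rq.1 hBq).1
    have hO : gr N \ clF N B ⊆ gr N \ B := sdiff_subset_sdiff (Subset.refl _) (subset_clF hBg)
    refine insert_subset ?_ (insert_subset (hO (hx₁ B hB).1) (singleton_subset_iff.2 (hO (hx₂ B hB).1)))
    exact mem_sdiff.2 ⟨clF_subset_gr _ (mem_sdiff.1 (hc B hB)).1, (mem_sdiff.1 (hc B hB)).2⟩
  have hfcard : ∀ B ∈ BP, (f B).card = 3 := by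
    intro B hB
    simp only [f]
    rw [card_insert_of_notMem (hcpair B hB), card_pair (hx₂ B hB).2.symm]
  have hfind : ∀ B ∈ BP, rk N (f B) = 3 := by
    intro B hB
    rw [rk_eq_card_of_subset_indepFin (hfsub B hB) (hmem B hB).2.2.2.2, hfcard B hB]
  -- the targets lie in `T_t`
  have hfT : ∀ B ∈ BP, f B ∈ levelSetCoQ N t 3 := by
    intro B hB
    rw [mem_levelSetCoQ]
    refine ⟨⟨(hfsub B hB).trans sdiff_subset, eRk_eq_of_rk_eq_cq (hfind B hB)⟩, ?_⟩
    have hsub : gr N \ f B ⊆ (Xof B).erase (x₁ B) := by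
      intro y hy
      rw [mem_sdiff] at hy
      simp only [f, mem_insert, mem_singleton, not_or] at hy
      exact mem_erase.2 ⟨hy.2.2.1, mem_erase.2 ⟨hy.2.1, hy.1⟩⟩
    rw [rk_eq_card_of_subset_indepFin hsub (hx₁ B hB).2,
      card_sdiff_of_subset ((hfsub B hB).trans sdiff_subset), hfcard B hB]
    omega
  -- the pair `(f B, c)` is free: `{x₁, x₂} ∉ L_t`
  have hfree : ∀ B ∈ BP, (f B).erase (cpt B) ∉ L := by
    intro B hB hmemL
    obtain ⟨hBq, _, hbad⟩ := hmem B hB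
    have hBg := (mem_Rq.1 hBq).1
    have hBrk : rk N B = 2 := rk_eq_of_eRk_eq_cq (mem_Rq.1 hBq).2
    have herase : (f B).erase (cpt B) = {x₁ B, x₂ B} := erase_insert (hcpair B hB)
    rw [herase, hL, mem_filter] at hmemL
    have hsub : gr N \ {x₁ B, x₂ B} ⊆ clF N B ∪ ((gr N \ clF N B) \ {x₁ B, x₂ B}) := by
      intro y hy
      rw [mem_sdiff] at hy
      by_cases hycl : y ∈ clF N B
      · exact mem_union_left _ hycl
      · exact mem_union_right _ (mem_sdiff.2 ⟨mem_sdiff.2 ⟨hy.1, hycl⟩, hy.2⟩)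
    have h1 : rk N (gr N \ {x₁ B, x₂ B}) ≤ rk N (clF N B) + rk N ((gr N \ clF N B) \ {x₁ B, x₂ B}) :=
      (rk_mono' hsub).trans (rk_union_le _ _)
    have h2 : rk N ((gr N \ clF N B) \ {x₁ B, x₂ B}) ≤ ((gr N \ clF N B) \ {x₁ B, x₂ B}).card := rk_le_card _
    have hpsub : ({x₁ B, x₂ B} : Finset α) ⊆ gr N \ clF N B :=
      insert_subset (hx₁ B hB).1 (singleton_subset_iff.2 (hx₂ B hB).1)
    have h3 : ((gr N \ clF N B) \ {x₁ B, x₂ B}).card = t - 2 := by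
      rw [card_sdiff_of_subset hpsub, card_pair (hx₂ B hB).2.symm, hOc B hB]
    rw [rk_clF, hBrk] at h1
    have := hmemL.2
    omega
  -- the targets are independent triples: every point is a coloop
  have hcol : ∀ B ∈ BP, coloops N (f B) = f B := by
    intro B hB
    apply Subset.antisymm (coloops_subset _)
    intro y hy
    apply mem_coloops_of_rk_erase ((hfsub B hB).trans sdiff_subset) hy
    rw [rk_eq_card_of_subset_indepFin (erase_subset _ _) (rk_eq_card_of_subset_indepFin (hfsub B hB) (hmem B hB).2.2.2.2),
      card_erase_of_mem hy, hfcard B hB, hfind B hB]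
  -- the fibre bound
  calc BP.card = ∑ S ∈ levelSetCoQ N t 3, (BP.filter (fun B => f B = S)).card :=
        card_eq_sum_card_fiberwise hfT
    _ ≤ ∑ S ∈ levelSetCoQ N t 3,
        (3 - ((coloops N S).filter (fun y => S.erase y ∈ L)).card) := by
        apply sum_le_sum
        intro S _
        rcases (BP.filter (fun B => f B = S)).eq_empty_or_nonempty with hemp | ⟨B₁, hB₁⟩
        · rw [hemp, card_empty]
          exact Nat.zero_le _
        rw [mem_filter] at hB₁
        obtain ⟨hB₁, rfl⟩ := hB₁
        rw [hcol B₁ hB₁, ← hfcard B₁ hB₁]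
        have hsplit : (f B₁).card = ((f B₁).filter (fun y => (f B₁).erase y ∈ L)).card +
            ((f B₁).filter (fun y => ¬ (f B₁).erase y ∈ L)).card := by
          rw [filter_not, card_sdiff_of_subset (filter_subset _ _)]
          have := card_le_card (filter_subset (fun y => (f B₁).erase y ∈ L) (f B₁))
          omega
        rw [hsplit, Nat.add_sub_cancel_left]
        apply card_le_card_of_injOn cpt
        · intro B hB
          rw [mem_coe, mem_filter] at hB
          obtain ⟨hB, hfB⟩ := hB
          rw [mem_coe, mem_filter, ← hfB]
          exact ⟨mem_insert_self _ _, hfree B hB⟩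
        · intro B hB B' hB' hcc
          rw [mem_coe, mem_filter] at hB hB'
          obtain ⟨hBq, _, hbad⟩ := hmem B hB.1
          obtain ⟨hBq', _, hbad'⟩ := hmem B' hB'.1
          exact eq_of_bad_of_mem_sdiff hpair hBq hBq' hbad hbad' (hc B hB.1) (hcc ▸ hc B' hB'.1)

end Disjoint

end PercRepro.Cogirth
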